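import Summits.HubbardSuperconductivity.HubbardSuperconductivity.Theorems.FunctionFieldCertificateMesoscopicPairOrderDanskin
import Mathlib.LinearAlgebra.Eigenspace.Triangularizable
import HarnessLib

/-!
# Crux `MesoscopicPairOrder` (stmt-HubbardSuperconductivity-7331), line `Sketch`:
# symmetry-adapted Rayleigh minimisers (abstract part of the Bloch reduction)

Support file for the crux (route `FunctionFieldCertificate`, pole-free half; lead c2 of line
`Sketch`). The crux asks for a margin of the Fejér-box pair functional in EVERY normalised sector
ground state — including every superposition inside a degenerate ground eigenspace. The companion
file `FunctionFieldCertificateMesoscopicPairOrderBloch.lean` reduces "every ground state" to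
"every BLOCH ground state" (joint eigenvector of the lattice translations); this file is its
model-free linear algebra:

* `exists_isMinOn_re_rayleigh` — the Rayleigh quotient `Re⟨φ, A φ⟩` attains its minimum on the
  unit vectors of a subspace `K` (compactness);
* `dotProduct_mulVec_eq_of_isMinOn` — FIRST VARIATION: a minimiser `φ` is a weak eigenvector,
  `⟨ψ, A φ⟩ = μ ⟨ψ, φ⟩` for all `ψ ∈ K` (`A` Hermitian; `K` need not be `A`-invariant);
* `exists_eigenvector_mem`, `exists_common_eigenvector_mem` — a matrix (two commuting matrices)
  has an eigenvector (a common eigenvector) in every nonzero (jointly) invariant subspace, from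
  Mathlib's `Module.End.exists_eigenvalue` over `ℂ`;
* `exists_unit_common_eigenvector_isMinOn` — for Hermitian `A` and two commuting matrices
  `T₁, T₂` commuting with `A` and preserving `K` together with their adjoints, the minimum of
  `Re⟨φ, A φ⟩` over the unit vectors of `K` is attained at a COMMON EIGENVECTOR of `T₁, T₂` (the
  weak eigenspace of the minimum is a nonzero jointly invariant subspace).

H. Tasaki, *Physics and Mathematics of Quantum Many-Body Systems* (2020) §2.1 (variational
principle); T. Kato, *Perturbation Theory for Linear Operators* (1966) I §6; folklore (commuting
operators have common eigenvectors over `ℂ`). No definition is introduced.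
-/

noncomputable section

-- the summit namespace `Summit.HubbardSuperconductivity.HubbardSuperconductivity.…` repeats the problem name by design (D-0017)
set_option linter.dupNamespace false

namespace Summit.HubbardSuperconductivity.HubbardSuperconductivity.Theorems.FunctionFieldCertificate

open Matrix Finset Filter
open Literature.Probability.LatticeModels Literature.MathematicalPhysics.QuantumLattice
open scoped ComplexOrder

/-! ### §1 Abstract finite-dimensional part -/

section Abstract

variable {n : Type*} [Fintype n] [DecidableEq n]

omit [DecidableEq n] in
/-- **The Rayleigh quotient attains its minimum on the unit vectors of a subspace** (the unit
sphere of `K` is compact in the finite-dimensional `n → ℂ`). Tasaki (2020) §2.1. [folklore] -/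
theorem exists_isMinOn_re_rayleigh (A : Matrix n n ℂ) (K : Submodule ℂ (n → ℂ))
    (hK : ∃ ψ ∈ K, star ψ ⬝ᵥ ψ = 1) :
    ∃ φ ∈ K, star φ ⬝ᵥ φ = 1 ∧
      ∀ ψ ∈ K, star ψ ⬝ᵥ ψ = 1 → (star φ ⬝ᵥ A *ᵥ φ).re ≤ (star ψ ⬝ᵥ A *ᵥ ψ).re := by
  set S : Set (n → ℂ) :=
    {φ | star φ ⬝ᵥ φ = 1 ∧ φ ∈ K ∧ (star φ ⬝ᵥ (0 : Matrix n n ℂ) *ᵥ φ).re ≤ 0} with hS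
  have hScpt : IsCompact S := isCompact_unit_inter_re_rayleigh_le 0 K 0
  have hmemS : ∀ φ : n → ℂ, φ ∈ S ↔ star φ ⬝ᵥ φ = 1 ∧ φ ∈ K := fun φ => by
    rw [hS, Set.mem_setOf_eq, zero_mulVec, dotProduct_zero, Complex.zero_re]
    tauto
  obtain ⟨ψ₁, hψ₁K, hψ₁⟩ := hK
  have hSne : S.Nonempty := ⟨ψ₁, (hmemS ψ₁).2 ⟨hψ₁, hψ₁K⟩⟩
  have hcont : Continuous fun φ : n → ℂ => (star φ ⬝ᵥ A *ᵥ φ).re :=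
    Complex.continuous_re.comp
      (continuous_star.dotProduct (continuous_const.matrix_mulVec continuous_id))
  obtain ⟨φ₀, hφ₀S, hmin⟩ := hScpt.exists_isMinOn hSne hcont.continuousOn
  obtain ⟨h01, h0K⟩ := (hmemS φ₀).1 hφ₀S
  exact ⟨φ₀, h0K, h01, fun ψ hψK hψ => hmin ((hmemS ψ).2 ⟨hψ, hψK⟩)⟩

omit [DecidableEq n] in
/-- Homogeneous form of minimality: if the unit vector `φ ∈ K` minimises `Re⟨·, A ·⟩` over the
unit vectors of `K`, then `Re⟨φ, A φ⟩ · Re⟨χ, χ⟩ ≤ Re⟨χ, A χ⟩` for every `χ ∈ K`. [folklore] -/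
theorem re_rayleigh_mul_le_of_isMinOn (A : Matrix n n ℂ) (K : Submodule ℂ (n → ℂ)) {φ : n → ℂ}
    (hmin : ∀ ψ ∈ K, star ψ ⬝ᵥ ψ = 1 → (star φ ⬝ᵥ A *ᵥ φ).re ≤ (star ψ ⬝ᵥ A *ᵥ ψ).re)
    {χ : n → ℂ} (hχ : χ ∈ K) :
    (star φ ⬝ᵥ A *ᵥ φ).re * (star χ ⬝ᵥ χ).re ≤ (star χ ⬝ᵥ A *ᵥ χ).re := by
  by_cases h0 : χ = 0
  · subst h0
    simp
  obtain ⟨c, hc0, hc1⟩ := exists_smul_unit h0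
  have hle := hmin (c • χ) (K.smul_mem c hχ) hc1
  rw [re_rayleigh_smul] at hle
  have h1 : ‖c‖ ^ 2 * (star χ ⬝ᵥ χ).re = 1 := by
    rw [← re_star_dotProduct_smul_self, hc1, Complex.one_re]
  have hpos : 0 < ‖c‖ ^ 2 := by positivity
  have key : ‖c‖ ^ 2 * ((star φ ⬝ᵥ A *ᵥ φ).re * (star χ ⬝ᵥ χ).re) ≤
      ‖c‖ ^ 2 * (star χ ⬝ᵥ A *ᵥ χ).re :=
    calc ‖c‖ ^ 2 * ((star φ ⬝ᵥ A *ᵥ φ).re * (star χ ⬝ᵥ χ).re)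
        = (star φ ⬝ᵥ A *ᵥ φ).re * (‖c‖ ^ 2 * (star χ ⬝ᵥ χ).re) := by ring
      _ = (star φ ⬝ᵥ A *ᵥ φ).re := by rw [h1, mul_one]
      _ ≤ ‖c‖ ^ 2 * (star χ ⬝ᵥ A *ᵥ χ).re := hle
  exact le_of_mul_le_mul_left key hpos

/-- **First variation: a Rayleigh minimiser is a weak eigenvector.** If `A` is Hermitian and the
unit vector `φ ∈ K` minimises `Re⟨·, A ·⟩` over the unit vectors of `K`, with value `μ`, then
`⟨ψ, A φ⟩ = μ ⟨ψ, φ⟩` for every `ψ ∈ K` (i.e. `P_K A φ = μ φ`; `K` need not be `A`-invariant).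
Proof: `t ↦ Re⟨φ + tψ, (A - μ)(φ + tψ)⟩ = 2t Re⟨ψ, (A - μ)φ⟩ + t² Re⟨ψ, (A - μ)ψ⟩ ≥ 0` for all
real `t` forces `Re⟨ψ, (A - μ)φ⟩ = 0`; replace `ψ` by `iψ` for the imaginary part.
Kato (1966) I §6.10; Tasaki (2020) §2.1. [folklore] -/
theorem dotProduct_mulVec_eq_of_isMinOn {A : Matrix n n ℂ} (hA : A.IsHermitian)
    (K : Submodule ℂ (n → ℂ)) {φ : n → ℂ} (hφ : star φ ⬝ᵥ φ = 1)
    (hmin : ∀ ψ ∈ K, star ψ ⬝ᵥ ψ = 1 → (star φ ⬝ᵥ A *ᵥ φ).re ≤ (star ψ ⬝ᵥ A *ᵥ ψ).re)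
    (hφK : φ ∈ K) {ψ : n → ℂ} (hψK : ψ ∈ K) :
    star ψ ⬝ᵥ A *ᵥ φ = (((star φ ⬝ᵥ A *ᵥ φ).re : ℝ) : ℂ) * (star ψ ⬝ᵥ φ) := by
  set μ : ℝ := (star φ ⬝ᵥ A *ᵥ φ).re with hμ
  set B : Matrix n n ℂ := A - ((μ : ℝ) : ℂ) • (1 : Matrix n n ℂ) with hB
  have hBH : B.IsHermitian := by
    unfold Matrix.IsHermitian
    rw [hB, conjTranspose_sub, conjTranspose_smul, conjTranspose_one, hA.eq, Complex.star_def,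
      Complex.conj_ofReal]
  have hBv : ∀ v : n → ℂ, B *ᵥ v = A *ᵥ v - ((μ : ℝ) : ℂ) • v := fun v => by
    rw [hB, sub_mulVec, smul_mulVec, one_mulVec]
  have hform : ∀ χ : n → ℂ, (star χ ⬝ᵥ B *ᵥ χ).re = (star χ ⬝ᵥ A *ᵥ χ).re - μ * (star χ ⬝ᵥ χ).re :=
    fun χ => by
      rw [hBv, dotProduct_sub, dotProduct_smul, Complex.sub_re, smul_eq_mul, Complex.re_ofReal_mul]
  -- `Re⟨χ, B χ⟩ ≥ 0` on `K`, `= 0` at `φ`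
  have hpos : ∀ χ ∈ K, 0 ≤ (star χ ⬝ᵥ B *ᵥ χ).re := fun χ hχ => by
    rw [hform]
    have := re_rayleigh_mul_le_of_isMinOn A K hmin hχ
    linarith
  -- the real part of the cross term vanishes for every direction in `K`
  have hre : ∀ χ ∈ K, (star χ ⬝ᵥ B *ᵥ φ).re = 0 := by
    intro χ hχ
    set a : ℝ := (star χ ⬝ᵥ B *ᵥ φ).re with ha
    set b : ℝ := (star χ ⬝ᵥ B *ᵥ χ).re with hb
    have hzero : (star φ ⬝ᵥ B *ᵥ φ).re = 0 := by
      rw [hform, hφ, Complex.one_re, mul_one, hμ, sub_self]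
    have hcross : star φ ⬝ᵥ B *ᵥ χ = star (star χ ⬝ᵥ B *ᵥ φ) := by
      rw [← star_mulVec_dotProduct_of_isHermitian hBH φ χ, star_dotProduct]
    have hexp : ∀ t : ℝ, (star (φ + (t : ℂ) • χ) ⬝ᵥ B *ᵥ (φ + (t : ℂ) • χ)).re =
        2 * t * a + t ^ 2 * b := by
      intro t
      have h1 : star (φ + (t : ℂ) • χ) ⬝ᵥ B *ᵥ (φ + (t : ℂ) • χ) =
          star φ ⬝ᵥ B *ᵥ φ + (t : ℂ) * (star φ ⬝ᵥ B *ᵥ χ) + (t : ℂ) * (star χ ⬝ᵥ B *ᵥ φ) +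
            (t : ℂ) * (t : ℂ) * (star χ ⬝ᵥ B *ᵥ χ) := by
        simp only [mulVec_add, mulVec_smul, star_add, star_smul, add_dotProduct, dotProduct_add,
          smul_dotProduct, dotProduct_smul, smul_eq_mul, Complex.star_def, Complex.conj_ofReal]
        ring
      rw [h1, hcross]
      simp only [Complex.add_re, Complex.re_ofReal_mul, hzero, Complex.star_def, Complex.conj_re]
      have h2 : ((t : ℂ) * (t : ℂ) * (star χ ⬝ᵥ B *ᵥ χ)).re = t ^ 2 * b := by
        rw [← Complex.ofReal_mul, Complex.re_ofReal_mul, sq]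
      rw [h2]
      ring
    -- test direction `t = -a/(|b|+1)`
    have hc : 0 < |b| + 1 := by positivity
    have h := hpos (φ + ((-a / (|b| + 1) : ℝ) : ℂ) • χ) (K.add_mem hφK (K.smul_mem _ hχ))
    rw [hexp] at h
    -- multiply by `(|b|+1)²`: `0 ≤ -2a²(|b|+1) + a² b ≤ -a²(|b|+2)`
    have h' : 0 ≤ (2 * (-a / (|b| + 1)) * a + (-a / (|b| + 1)) ^ 2 * b) * (|b| + 1) ^ 2 :=
      mul_nonneg h (by positivity)
    have hcalc : (2 * (-a / (|b| + 1)) * a + (-a / (|b| + 1)) ^ 2 * b) * (|b| + 1) ^ 2 =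
        -(2 * a ^ 2 * (|b| + 1)) + a ^ 2 * b := by
      field_simp
    rw [hcalc] at h'
    have hb' : a ^ 2 * b ≤ a ^ 2 * |b| := mul_le_mul_of_nonneg_left (le_abs_self b) (sq_nonneg a)
    nlinarith [sq_nonneg a, abs_nonneg b]
  -- real and imaginary parts
  have h1 := hre ψ hψK
  have h2 := hre (Complex.I • ψ) (K.smul_mem _ hψK)
  rw [star_smul, smul_dotProduct, smul_eq_mul, Complex.star_def, Complex.conj_I, neg_mul,
    Complex.neg_re, Complex.I_mul_re, neg_neg] at h2
  have hz : star ψ ⬝ᵥ B *ᵥ φ = 0 := Complex.ext h1 h2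
  rw [hBv, dotProduct_sub, dotProduct_smul, smul_eq_mul, sub_eq_zero] at hz
  exact hz

/-- **A matrix has an eigenvector in every nonzero invariant subspace** (over `ℂ`; Mathlib's
`Module.End.exists_eigenvalue` for the restricted endomorphism). [folklore] -/
theorem exists_eigenvector_mem (T : Matrix n n ℂ) (W : Submodule ℂ (n → ℂ)) (hW : W ≠ ⊥)
    (hT : ∀ w ∈ W, T *ᵥ w ∈ W) : ∃ w ∈ W, w ≠ 0 ∧ ∃ c : ℂ, T *ᵥ w = c • w := by
  have hT' : ∀ w ∈ W, Matrix.toLin' T w ∈ W := fun w hw => by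
    rw [Matrix.toLin'_apply]
    exact hT w hw
  haveI : Nontrivial W := Submodule.nontrivial_iff_ne_bot.2 hW
  set f : Module.End ℂ W := (Matrix.toLin' T).restrict hT' with hf
  obtain ⟨c, hc⟩ := Module.End.exists_eigenvalue f
  obtain ⟨v, hv⟩ := hc.exists_hasEigenvector
  refine ⟨(v : n → ℂ), v.2, fun h => hv.2 (Subtype.ext h), c, ?_⟩
  have h := congrArg Subtype.val hv.apply_eq_smul
  rw [hf, LinearMap.coe_restrict_apply, Matrix.toLin'_apply] at h
  rw [h, Submodule.coe_smul]

/-- **Two commuting matrices have a common eigenvector in every nonzero jointly invariant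
subspace.** (Take an eigenvector of `T₁` in `W`; its `T₁`-eigenspace inside `W` is nonzero and
`T₂`-invariant; take an eigenvector of `T₂` there.) [folklore] -/
theorem exists_common_eigenvector_mem (T₁ T₂ : Matrix n n ℂ) (h12 : Commute T₁ T₂)
    (W : Submodule ℂ (n → ℂ)) (hW : W ≠ ⊥)
    (h1 : ∀ w ∈ W, T₁ *ᵥ w ∈ W) (h2 : ∀ w ∈ W, T₂ *ᵥ w ∈ W) :
    ∃ w ∈ W, w ≠ 0 ∧ (∃ c₁ : ℂ, T₁ *ᵥ w = c₁ • w) ∧ (∃ c₂ : ℂ, T₂ *ᵥ w = c₂ • w) := by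
  obtain ⟨w₁, hw₁W, hw₁0, c₁, hw₁⟩ := exists_eigenvector_mem T₁ W hW h1
  set W₁ : Submodule ℂ (n → ℂ) := W ⊓ Module.End.eigenspace (Matrix.toLin' T₁) c₁ with hW₁
  have hmem : ∀ w : n → ℂ, w ∈ W₁ ↔ w ∈ W ∧ T₁ *ᵥ w = c₁ • w := fun w => by
    rw [hW₁, Submodule.mem_inf, Module.End.mem_eigenspace_iff, Matrix.toLin'_apply]
  have hW₁ne : W₁ ≠ ⊥ := by
    rw [Submodule.ne_bot_iff]
    exact ⟨w₁, (hmem w₁).2 ⟨hw₁W, hw₁⟩, hw₁0⟩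
  have h2' : ∀ w ∈ W₁, T₂ *ᵥ w ∈ W₁ := by
    intro w hw
    obtain ⟨hwW, hw1⟩ := (hmem w).1 hw
    refine (hmem _).2 ⟨h2 w hwW, ?_⟩
    rw [mulVec_mulVec, h12.eq, ← mulVec_mulVec, hw1, mulVec_smul]
  obtain ⟨w, hwW₁, hw0, c₂, hw₂⟩ := exists_eigenvector_mem T₂ W₁ hW₁ne h2'
  obtain ⟨hwW, hw1⟩ := (hmem w).1 hwW₁
  exact ⟨w, hwW, hw0, ⟨c₁, hw1⟩, ⟨c₂, hw₂⟩⟩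

omit [DecidableEq n] in
/-- `⟨ψ, T v⟩ = ⟨Tᴴ ψ, v⟩`. [folklore] -/
theorem dotProduct_mulVec_eq_star_conjTranspose_mulVec_dotProduct (T : Matrix n n ℂ) (ψ v : n → ℂ) :
    star ψ ⬝ᵥ T *ᵥ v = star (Tᴴ *ᵥ ψ) ⬝ᵥ v := by
  rw [star_mulVec, conjTranspose_conjTranspose, dotProduct_mulVec]

/-- **Symmetry-adapted Rayleigh minimisers.** Let `A` be Hermitian, `K` a subspace containing a
unit vector, and `T₁, T₂` two commuting matrices that commute with `A` and preserve `K` together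
with their adjoints (e.g. two commuting unitaries of a symmetry group of `A` and `K`). Then the
minimum of `Re⟨φ, A φ⟩` over the unit vectors of `K` is attained at a common eigenvector of `T₁`
and `T₂`. Proof: the weak eigenspace `W = {φ ∈ K | ∀ ψ ∈ K, ⟨ψ, A φ⟩ = μ ⟨ψ, φ⟩}` of the minimum
`μ` is a nonzero (`dotProduct_mulVec_eq_of_isMinOn`) subspace invariant under `T₁, T₂`, every
unit vector of `W` attains `μ`, and `exists_common_eigenvector_mem` applies. Tasaki (2020) §2.1,
§4.1; folklore (simultaneous diagonalisation of commuting normal operators). [folklore] -/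
theorem exists_unit_common_eigenvector_isMinOn {A T₁ T₂ : Matrix n n ℂ} (hA : A.IsHermitian)
    (K : Submodule ℂ (n → ℂ)) (hK : ∃ ψ ∈ K, star ψ ⬝ᵥ ψ = 1) (h12 : Commute T₁ T₂)
    (hA1 : Commute T₁ A) (hA2 : Commute T₂ A)
    (hK1 : ∀ v ∈ K, T₁ *ᵥ v ∈ K) (hK1' : ∀ v ∈ K, T₁ᴴ *ᵥ v ∈ K)
    (hK2 : ∀ v ∈ K, T₂ *ᵥ v ∈ K) (hK2' : ∀ v ∈ K, T₂ᴴ *ᵥ v ∈ K) :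
    ∃ φ ∈ K, star φ ⬝ᵥ φ = 1 ∧ (∃ c₁ : ℂ, T₁ *ᵥ φ = c₁ • φ) ∧ (∃ c₂ : ℂ, T₂ *ᵥ φ = c₂ • φ) ∧
      ∀ ψ ∈ K, star ψ ⬝ᵥ ψ = 1 → (star φ ⬝ᵥ A *ᵥ φ).re ≤ (star ψ ⬝ᵥ A *ᵥ ψ).re := by
  obtain ⟨φ₀, h0K, h01, hmin⟩ := exists_isMinOn_re_rayleigh A K hK
  set μ : ℝ := (star φ₀ ⬝ᵥ A *ᵥ φ₀).re with hμ
  -- the weak eigenspace of the minimum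
  set W : Submodule ℂ (n → ℂ) :=
    { carrier := {φ | φ ∈ K ∧ ∀ ψ ∈ K, star ψ ⬝ᵥ A *ᵥ φ = ((μ : ℝ) : ℂ) * (star ψ ⬝ᵥ φ)}
      add_mem' := by
        rintro a b ⟨haK, ha⟩ ⟨hbK, hb⟩
        refine ⟨K.add_mem haK hbK, fun ψ hψ => ?_⟩
        rw [mulVec_add, dotProduct_add, dotProduct_add, ha ψ hψ, hb ψ hψ, mul_add]
      zero_mem' := ⟨K.zero_mem, fun ψ _ => by simp⟩
      smul_mem' := by
        rintro c a ⟨haK, ha⟩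
        refine ⟨K.smul_mem c haK, fun ψ hψ => ?_⟩
        rw [mulVec_smul, dotProduct_smul, dotProduct_smul, ha ψ hψ, smul_eq_mul, smul_eq_mul]
        ring } with hW
  have hmemW : ∀ φ : n → ℂ, φ ∈ W ↔
      φ ∈ K ∧ ∀ ψ ∈ K, star ψ ⬝ᵥ A *ᵥ φ = ((μ : ℝ) : ℂ) * (star ψ ⬝ᵥ φ) := fun φ => Iff.rfl
  have hφ₀W : φ₀ ∈ W :=
    (hmemW φ₀).2 ⟨h0K, fun ψ hψ => dotProduct_mulVec_eq_of_isMinOn hA K h01 hmin h0K hψ⟩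
  have hφ₀0 : φ₀ ≠ 0 := by
    intro h
    rw [h, star_zero, zero_dotProduct] at h01
    exact zero_ne_one h01
  have hWne : W ≠ ⊥ := by
    rw [Submodule.ne_bot_iff]
    exact ⟨φ₀, hφ₀W, hφ₀0⟩
  -- invariance of `W` under a matrix commuting with `A` and preserving `K` with its adjoint
  have hinv : ∀ T : Matrix n n ℂ, Commute T A → (∀ v ∈ K, T *ᵥ v ∈ K) →
      (∀ v ∈ K, Tᴴ *ᵥ v ∈ K) → ∀ φ ∈ W, T *ᵥ φ ∈ W := by
    intro T hTA hTK hTK' φ hφ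
    obtain ⟨hφK, hφw⟩ := (hmemW φ).1 hφ
    refine (hmemW _).2 ⟨hTK φ hφK, fun ψ hψ => ?_⟩
    rw [mulVec_mulVec, ← hTA.eq, ← mulVec_mulVec,
      dotProduct_mulVec_eq_star_conjTranspose_mulVec_dotProduct T ψ (A *ᵥ φ),
      hφw _ (hTK' ψ hψ), ← dotProduct_mulVec_eq_star_conjTranspose_mulVec_dotProduct]
  obtain ⟨w, hwW, hw0, ⟨c₁, hw1⟩, ⟨c₂, hw2⟩⟩ := exists_common_eigenvector_mem T₁ T₂ h12 W hWne
    (hinv T₁ hA1 hK1 hK1') (hinv T₂ hA2 hK2 hK2')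
  -- normalise
  obtain ⟨c, hc0, hc1⟩ := exists_smul_unit hw0
  have hcwW : c • w ∈ W := W.smul_mem c hwW
  obtain ⟨hcwK, hcw⟩ := (hmemW _).1 hcwW
  refine ⟨c • w, hcwK, hc1, ⟨c₁, by rw [mulVec_smul, hw1, smul_comm]⟩,
    ⟨c₂, by rw [mulVec_smul, hw2, smul_comm]⟩, fun ψ hψK hψ => ?_⟩
  -- every unit vector of `W` attains `μ`
  have hval : (star (c • w) ⬝ᵥ A *ᵥ (c • w)).re = μ := by
    rw [hcw _ hcwK, hc1, mul_one, Complex.ofReal_re]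
  rw [hval]
  exact hmin ψ hψK hψ

end Abstract

/-- **Registered form of the symmetry-adapted minimiser** (sub-goal `blochMinimiser` of crux
stmt-HubbardSuperconductivity-7331, line `Sketch`; verbatim `exists_unit_common_eigenvector_isMinOn`
with all binders after the colon). [folklore] -/
theorem blochMinimiser : ∀ {n : Type} [Fintype n] [DecidableEq n] (A T₁ T₂ : Matrix n n ℂ) (K : Submodule ℂ (n → ℂ)), A.IsHermitian → (∃ ψ ∈ K, star ψ ⬝ᵥ ψ = 1) → Commute T₁ T₂ → Commute T₁ A → Commute T₂ A → (∀ v ∈ K, T₁ *ᵥ v ∈ K) → (∀ v ∈ K, T₁ᴴ *ᵥ v ∈ K) → (∀ v ∈ K, T₂ *ᵥ v ∈ K) → (∀ v ∈ K, T₂ᴴ *ᵥ v ∈ K) → ∃ φ ∈ K, star φ ⬝ᵥ φ = 1 ∧ (∃ c₁ : ℂ, T₁ *ᵥ φ = c₁ • φ) ∧ (∃ c₂ : ℂ, T₂ *ᵥ φ = c₂ • φ) ∧ ∀ ψ ∈ K, star ψ ⬝ᵥ ψ = 1 → (star φ ⬝ᵥ A *ᵥ φ).re ≤ (star ψ ⬝ᵥ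 A *ᵥ ψ).re :=
  fun _ _ _ K hA hK h12 hA1 hA2 hK1 hK1' hK2 hK2' =>
    exists_unit_common_eigenvector_isMinOn hA K hK h12 hA1 hA2 hK1 hK1' hK2 hK2'

end Summit.HubbardSuperconductivity.HubbardSuperconductivity.Theorems.FunctionFieldCertificate
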